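/-
Copyright (c) 2026 the pub-hodgecm-mathlib formalisation cell (harness21).  Prover seat hodgecm-mathlib-LH4-p08 (g9), req620 Track A «(D-RAM) FOUR-FRAME» squad, helper lane
on h413 = stmt-HodgeConjecture-24833 (count-neutral).  STAGE-1b, row (2), RamM lane of the (LAW) END — dealer LH4-plan (g13) WORD #97 (R2), second hand to LH4-p07 (g9).  2026-09-04.
-/
import Summits.HodgeConjecture.HodgeConjecture.Theorems.F0P3cDyRamToricCensusSumRamMWeld          -- ★ (LH4-p04 (g5)): the unit weld (letters + proof template); brings ★ Reindex `levelSet_eq_empty_of_succ_le_ramified`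
import Summits.HodgeConjecture.HodgeConjecture.Theorems.F0P3cDyRamToricCensusSumRamMCutOffset     -- ★ (LH4-p04 (g7)): `toricCensusSum_ramM_cut_offset` (standard class)
import Summits.HodgeConjecture.HodgeConjecture.Theorems.F0P3cDyRamToricCensusSumRamMFlipCutoff    -- ★ p859973 (LH4-p04 (g7)): `toricCensusSum_ramM_flip_cut_offset` (flipped class)
import HarnessLib

/-!
# Crux `H413`, line LH4 «(D-RAM) FOUR-FRAME» — STAGE-1b, row (2): (T5-P-weldΔ)-RamM «THE LEVEL-PIECE WELD, TYPE RamM, modulo the per-cell facts» (both parity classes)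
# `ε·Σ_{j ≤ jl} Σ_a q^a·[j + a ≤ C]·(#levelSetDep_h(j,a;μ) − #levelSetDep_{h′}(j,a;μ)) = q^m(2[(jl−g)∕2+1]_q − 2[d_E − d_E%2]_q) − 2·Σ_{band} q^{a + (jl+s0)∕2}`

Cell `hodgecm-mathlib` (D-0151), FLOOR 0, crux item H413 = `stmt-HodgeConjecture-24833`, route of record `HCCMUnconditional`; squad F0∕P3c∕LH4 (req618∕req620); helper lane
`--supports stmt-HodgeConjecture-24833 --as helper` (count-neutral).  THEOREMS ONLY (no `def`, no instance, no notation, no `sorry`; default heartbeats).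

THE OBJECT (dealer WORD #97 (R2); LH4-p07 (g9) SCOPE-RamM-lane v1 48fdfff2, row (R2); the type-RamM twin of LH4-p07 (g9)'s ★ p859906 ∕ ★ p859944 for type RamK and of this
lineage's ★ p860037 for type U).  The RamM level socket `levelsCensusC` receives the G-side of a level piece `lev_{a′,b′}` as the census difference of the two line models over the
cone cells of the SCALED multiplier `μ₁ = (ιϖ^{a′})⁻¹(λ − ιu₀)` (tokens `(m₁, jl₁) = (m − a′, jl − a′)`), summed with the DIAGONAL CUTOFF `[j + a ≤ C]`, `C = m + jl − b′`.  ★ LH4-p04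
(g5) `toricCensusSum_ramM_weld` is the UNCUT weld of an ABSTRACT multiplier `μ` with abstract tokens `(g, s0, jl, m)` MODULO THE PER-CELL FACTS of the RamM level census ((C-1P)∕(C-1M)
u-free tables, (C-2GEN)∕(C-2OFF) depth rules, (C-2TOPnear) near top cells agree, (C-2TOPfar) far top cells carry the ε-bit) — a statement-first interface whose dischargers are ★
(`…RamMWeldOfFrame`).  THIS FILE is the same interface WITH THE CUT and WITH THE ALIVE OFFSET `e` of a scaled multiplier in the far top cells (`2j + d_E ≤ 2jl + 1 + e`, `e ≤ d_E`,
`d_E = g + s0`; LH4-p07 (g9)'s ★ p859832 observation), over ★ LH4-p04 (g7) `toricCensusSum_ramM_cut_offset` ∕ ★ p859973 `toricCensusSum_ramM_flip_cut_offset` instead of T5s v2: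
* **`toricCensusSum_ramM_weld_cut`** (standard class: `jl ≡ g`, `m ≡ g + s0 (2)`, ★ cut-offset's guards) and **`toricCensusSum_ramM_weld_cut_flip`** (flipped class: `jl ≢ g`,
  `m ≢ g + s0`, ★ p859973's guards): `ε·Σ_{j<jl+1} Σ_{a<jl+2} q^a·[j + a ≤ C]·((#levelSetDep_h(j,a;μ) : ℚ) − #levelSetDep_{h′}(j,a;μ))` = the ★ cut identity's value VERBATIM.
Proof = ★ `toricCensusSum_ramM_weld`'s table assembly (adapted-from credit: LH4-p04 (g5)) with ONE new point: the ★ cut identities ask EXPLICIT values on every top cell (`hvTopE`),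
while the RamM near top cells are only known to AGREE ((C-2TOPnear), ★ p858164's currency) — so the tables `vP ∕ vM` carry the explicit alive-offset value on the NEAR top cells
(where both sides then coincide and the cut difference is `0` either way) and the census elsewhere; far top cells match `hvTopE` by (C-2TOPfarE) (`j + a ≥ m + s0`, the bit doubles).
CONSUMERS: the scaled dischargers — (C-1) ★ tables (μ-free), (C-2GEN)∕(C-2OFF) ★ `levelSetDep_eq_of_generic_ramified` at `(m₁, jl₁, μ₁)`, (C-2TOP) = (R1) «scaled top value RamM»
(LH4-p06 (g7), WORD #97) — assemble `…_of_frame` exactly as ★ `toricCensusSum_ramM_weld_of_frame` does for the unit weld; then (R3) OC-weld and (R4) law arithmetic.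
HONEST LABEL.  Count-neutral; abstract one-field frame and abstract multiplier, no CM place, no law asserted; the per-cell facts are HYPOTHESES (nothing about their truth is claimed
here); `HC_CM` is proved only modulo the 7 printed citations (2 remaining named inputs: hLiu418 = `stmt-HodgeConjecture-24832`, h413 = `stmt-HodgeConjecture-24833`) until rung 0 closes.

## References
* [Kottwitz1986BaseChangeUnits] R. E. Kottwitz, *Base change for unit elements of Hecke algebras*, Compositio Math. 60 (1986): §1 pp. 240–241.
* [Rogawski1990] J. D. Rogawski, *Automorphic Representations of Unitary Groups in Three Variables*, Ann. of Math. Stud. 123 (1990): §4.9 Prop. 4.9.1 (b) p. 55, Lemma 4.9.3 p. 56.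
* [Flicker1998UnitaryFL] Y. Z. Flicker, *Elementary proof of the fundamental lemma for a unitary group*, Canad. J. Math. 50 (1998): Prop. 7 p. 84.
* [Jacobowitz1962] R. Jacobowitz, *Hermitian forms over local fields*, Amer. J. Math. 84 (1962): §4.
-/

set_option autoImplicit false

open WithZero IsLocalRing Finset
open scoped Valued Classical

namespace Summit.HodgeConjecture.HodgeConjecture.Cruxes.H413.F0P3cDyRamToricCensusSumRamMWeldCut

open Literature.NumberTheory.Automorphic.UnitaryThreeFourFrame (IsRamifiedQuadraticDatum)
open Summit.HodgeConjecture.HodgeConjecture.Cruxes.H413.F0P3cDyRamToricCensusDefs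
open Summit.HodgeConjecture.HodgeConjecture.Cruxes.H413.F0P3cDyRamToricLevelCensusRamM (levelSet_eq_empty_of_succ_le_ramified)
open Summit.HodgeConjecture.HodgeConjecture.Cruxes.H413.F0P3cDyRamToricCensusSumRamMCutOffset (toricCensusSum_ramM_cut_offset)
open Summit.HodgeConjecture.HodgeConjecture.Cruxes.H413.F0P3cDyRamToricCensusSumRamMFlipCutoff (toricCensusSum_ramM_flip_cut_offset)

variable {K : Type} [Field K] [Valued K ℤᵐ⁰] {ρ Θ : K →+* K} {α ϖE h h' : K} {dρ t : ℕ}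

/-! ## §1 Standard parity class -/

/-- **(T5-P-weldΔ)-RamM, STANDARD CLASS — THE CUT WELD modulo the per-cell facts.**  ★ `toricCensusSum_ramM_weld`'s frame (`hD`, `|ϖE| = exp(−2)`, `ρϖE = ϖE`, `h, h′ ≠ 0`), the
token-side facts of ★ `toricCensusSum_ramM_cut_offset` (`2 ≤ q`, `1 ≤ g`, `1 ≤ s0`, `jl ≡ g`, `3g + 2s0 ≤ jl + 2 + 2(d_E%2)`, `m ≡ d_E`, `d_E − d_E%2 ≤ m + 1`, `m ≤ jl`,
`ε = 1 ∨ (ε = −1 ∧ window)`), the per-cell facts (C-1P)∕(C-1M)∕(C-2GEN)∕(C-2OFF)∕(C-2TOPnear) VERBATIM and (C-2TOPfarE) with the alive offset `e ≤ d_E`, a cutoff `jl ≤ C`,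
`C + d_E ≤ m + jl + 1`:  `ε·Σ_{j<jl+1} Σ_{a<jl+2} q^a·[j + a ≤ C]·(#levelSetDep_h(j,a;μ) − #levelSetDep_{h′}(j,a;μ))` = ★ cut-offset's value.
[cite: Kottwitz1986BaseChangeUnits, §1 pp. 240–241] [cite: Rogawski1990, §4.9 Prop. 4.9.1 (b) p. 55, Lemma 4.9.3 p. 56] [cite: Flicker1998UnitaryFL, Prop. 7 p. 84] [cite: Jacobowitz1962, §4] -/
theorem toricCensusSum_ramM_weld_cut (hD : IsRamifiedQuadraticDatum ρ α dρ t) (hvΘ : ∀ x, Valued.v (Θ x) = Valued.v x)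
    (hρϖ : ρ ϖE = ϖE) (hϖE : Valued.v ϖE = exp (-2 : ℤ)) (hh : h ≠ 0) (hh' : h' ≠ 0)
    (q : ℕ) {g s0 jl m : ℕ} (ε : ℚ) (hq : 2 ≤ q) (hg : 1 ≤ g) (hs0 : 1 ≤ s0) (hjl : jl % 2 = g % 2)
    (hjlS : 3 * g + 2 * s0 ≤ jl + 2 + 2 * ((g + s0) % 2)) (hpar : m % 2 = (g + s0) % 2)
    (hmS : g + s0 - (g + s0) % 2 ≤ m + 1) (hm : m ≤ jl) (hε : ε = 1 ∨ (ε = -1 ∧ jl + 2 ≤ m + 2 * g + s0)) {μ : K}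
    (hC1P : ∀ j a, (levelSet ρ Θ α ϖE h j a).ncard = (if j = 0 then (if a = 0 then 1 else 0) else if j < a then 0
      else if j - a + 1 = s0 then q ^ j else if j - a + 1 < s0 then (if a = 0 then q ^ j else 0) else if (j - a - s0) % 2 = 1 then 0
      else if a = 0 then (if 2 * g ≤ j - a - s0 then 2 else 1) * q ^ (j - (j - a - s0) / 2)
      else if j - a - s0 + 2 < 2 * g then (q - 1) * q ^ (j - 1 - (j - a - s0) / 2) else if j - a - s0 + 2 = 2 * g then (q - 2) * q ^ (j - 1 - (j - a - s0) / 2)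
      else 2 * (q - 1) * q ^ (j - 1 - (j - a - s0) / 2) : ℕ))
    (hC1M : ∀ j a, (levelSet ρ Θ α ϖE h' j a).ncard = (if j = 0 then (if a = 0 then 1 else 0) else if j < a then 0
      else if j - a + 1 = s0 then q ^ j else if j - a + 1 < s0 then (if a = 0 then q ^ j else 0) else if (j - a - s0) % 2 = 1 then 0
      else if a = 0 then (if j - a - s0 + 2 ≤ 2 * g then q ^ (j - (j - a - s0) / 2) else 0)
      else if j - a - s0 + 2 < 2 * g then (q - 1) * q ^ (j - 1 - (j - a - s0) / 2) else if j - a - s0 + 2 = 2 * g then q ^ (j - (j - a - s0) / 2) else 0 : ℕ))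
    (hC2GEN : ∀ j a, j ≤ jl → a ≤ j → (a ≤ m ∧ (j + a ≤ m ∨ (2 * a ≤ m ∧ j + a ≤ jl))) →
      levelSetDep ρ Θ α ϖE h j a μ = levelSet ρ Θ α ϖE h j a ∧ levelSetDep ρ Θ α ϖE h' j a μ = levelSet ρ Θ α ϖE h' j a)
    (hC2OFF : ∀ j a, j ≤ jl → a ≤ j → ¬ (a ≤ m ∧ (j + a ≤ m ∨ (2 * a ≤ m ∧ j + a ≤ jl))) → j + m ≠ jl + a →
      levelSetDep ρ Θ α ϖE h j a μ = ∅ ∧ levelSetDep ρ Θ α ϖE h' j a μ = ∅)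
    (hC2TOPnear : ∀ j a, j ≤ jl → a ≤ j → ¬ (a ≤ m ∧ (j + a ≤ m ∨ (2 * a ≤ m ∧ j + a ≤ jl))) → j + m = jl + a → j + a + 2 ≤ m + s0 + 2 * g →
      (levelSetDep ρ Θ α ϖE h j a μ).ncard = (levelSetDep ρ Θ α ϖE h' j a μ).ncard)
    (e : ℕ) (hed : e ≤ g + s0)
    (hC2TOPfarE : ∀ j a, j ≤ jl → a ≤ j → ¬ (a ≤ m ∧ (j + a ≤ m ∨ (2 * a ≤ m ∧ j + a ≤ jl))) → j + m = jl + a → ¬ (j + a + 2 ≤ m + s0 + 2 * g) →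
      (((levelSetDep ρ Θ α ϖE h j a μ).ncard : ℚ) = if 2 * j + (g + s0) ≤ 2 * jl + 1 + e ∧ ε = 1 then 2 * (q : ℚ) ^ (j - (j + a - m - s0 + 1) / 2) else 0) ∧
      (((levelSetDep ρ Θ α ϖE h' j a μ).ncard : ℚ) = if 2 * j + (g + s0) ≤ 2 * jl + 1 + e ∧ ε = -1 then 2 * (q : ℚ) ^ (j - (j + a - m - s0 + 1) / 2) else 0))
    (C : ℕ) (hC : jl ≤ C) (hCe : C + (g + s0) ≤ m + jl + 1) :
    ε * ∑ j ∈ range (jl + 1), ∑ a ∈ range (jl + 2), (q : ℚ) ^ a *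
        (if j + a ≤ C then ((levelSetDep ρ Θ α ϖE h j a μ).ncard : ℚ) - ((levelSetDep ρ Θ α ϖE h' j a μ).ncard : ℚ) else 0) =
      (q : ℚ) ^ m * (2 * ∑ i ∈ range ((jl - g) / 2 + 1), (q : ℚ) ^ i - 2 * ∑ i ∈ range (g + s0 - (g + s0) % 2), (q : ℚ) ^ i) -
        2 * ∑ a ∈ (range (jl + 2)).filter (fun a => a ≤ m ∧ C + m < jl + 2 * a ∧ 2 * m + 2 * g + s0 < jl + 2 * a + 2 ∧ 2 * a + (g + s0) ≤ 2 * m + 1),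
          (q : ℚ) ^ (a + (jl + s0) / 2) := by
  classical
  -- cells `a > j` are empty on both scalars, with or without the depth condition (adapted from ★ `toricCensusSum_ramM_weld`, LH4-p04 (g5))
  have hEmp : ∀ (s : K), s ≠ 0 → ∀ j a, j < a → levelSet ρ Θ α ϖE s j a = ∅ := fun s hs j a hja =>
    levelSet_eq_empty_of_succ_le_ramified (Θ := Θ) hD hvΘ hρϖ hϖE hs (by omega)
  have hEmpD : ∀ (s : K), s ≠ 0 → ∀ j a, j < a → ∀ μ' : K, levelSetDep ρ Θ α ϖE s j a μ' = ∅ := fun s hs j a hja μ' =>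
    Set.subset_eq_empty (levelSetDep_subset ρ Θ α ϖE s j a μ') (hEmp s hs j a hja)
  -- the tables: the census, except on the NEAR top cells where both sides carry the explicit alive-offset value
  obtain ⟨nP, hnPdef⟩ : ∃ f : ℕ → ℕ → ℚ, f = fun j a => ((levelSet ρ Θ α ϖE h j a).ncard : ℚ) := ⟨_, rfl⟩
  obtain ⟨nM, hnMdef⟩ : ∃ f : ℕ → ℕ → ℚ, f = fun j a => ((levelSet ρ Θ α ϖE h' j a).ncard : ℚ) := ⟨_, rfl⟩
  obtain ⟨vP, hvPdef⟩ : ∃ f : ℕ → ℕ → ℚ, f = fun j a => if j ≤ jl then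
      (if ¬ (a ≤ m ∧ (j + a ≤ m ∨ (2 * a ≤ m ∧ j + a ≤ jl))) ∧ j + m = jl + a ∧ j + a + 2 ≤ m + s0 + 2 * g then
        (if 2 * j + (g + s0) ≤ 2 * jl + 1 + e ∧ (j + a + 2 ≤ m + s0 + 2 * g ∨ ε = 1) then
          (if j + a < m + s0 then (q : ℚ) ^ j else (if 2 * g ≤ j + a - m - s0 + 1 then 2 else 1) * (q : ℚ) ^ (j - (j + a - m - s0 + 1) / 2)) else 0)
      else ((levelSetDep ρ Θ α ϖE h j a μ).ncard : ℚ)) else 0 := ⟨_, rfl⟩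
  obtain ⟨vM, hvMdef⟩ : ∃ f : ℕ → ℕ → ℚ, f = fun j a => if j ≤ jl then
      (if ¬ (a ≤ m ∧ (j + a ≤ m ∨ (2 * a ≤ m ∧ j + a ≤ jl))) ∧ j + m = jl + a ∧ j + a + 2 ≤ m + s0 + 2 * g then
        (if 2 * j + (g + s0) ≤ 2 * jl + 1 + e ∧ (j + a + 2 ≤ m + s0 + 2 * g ∨ ε = -1) then
          (if j + a < m + s0 then (q : ℚ) ^ j else (if 2 * g ≤ j + a - m - s0 + 1 then 2 else 1) * (q : ℚ) ^ (j - (j + a - m - s0 + 1) / 2)) else 0)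
      else ((levelSetDep ρ Θ α ϖE h' j a μ).ncard : ℚ)) else 0 := ⟨_, rfl⟩
  have hnP : ∀ j a, nP j a = ((if j = 0 then (if a = 0 then 1 else 0) else if j < a then 0
      else if j - a + 1 = s0 then q ^ j else if j - a + 1 < s0 then (if a = 0 then q ^ j else 0) else if (j - a - s0) % 2 = 1 then 0
      else if a = 0 then (if 2 * g ≤ j - a - s0 then 2 else 1) * q ^ (j - (j - a - s0) / 2)
      else if j - a - s0 + 2 < 2 * g then (q - 1) * q ^ (j - 1 - (j - a - s0) / 2) else if j - a - s0 + 2 = 2 * g then (q - 2) * q ^ (j - 1 - (j - a - s0) / 2)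
      else 2 * (q - 1) * q ^ (j - 1 - (j - a - s0) / 2) : ℕ) : ℚ) := fun j a => by
    rw [hnPdef]; dsimp only; rw [hC1P j a]
  have hnM : ∀ j a, nM j a = ((if j = 0 then (if a = 0 then 1 else 0) else if j < a then 0
      else if j - a + 1 = s0 then q ^ j else if j - a + 1 < s0 then (if a = 0 then q ^ j else 0) else if (j - a - s0) % 2 = 1 then 0
      else if a = 0 then (if j - a - s0 + 2 ≤ 2 * g then q ^ (j - (j - a - s0) / 2) else 0)
      else if j - a - s0 + 2 < 2 * g then (q - 1) * q ^ (j - 1 - (j - a - s0) / 2) else if j - a - s0 + 2 = 2 * g then q ^ (j - (j - a - s0) / 2) else 0 : ℕ) : ℚ) :=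
    fun j a => by rw [hnMdef]; dsimp only; rw [hC1M j a]
  -- (3) `hvGen`: generic cells pass wholly (C-2GEN); `a > j` cells are empty on both counts
  have hvGen : ∀ j a, (a ≤ m ∧ (j + a ≤ m ∨ (2 * a ≤ m ∧ j + a ≤ jl))) → vP j a = nP j a ∧ vM j a = nM j a := by
    intro j a hG
    have hj : j ≤ jl := by omega
    have hnt : ¬ (¬ (a ≤ m ∧ (j + a ≤ m ∨ (2 * a ≤ m ∧ j + a ≤ jl))) ∧ j + m = jl + a ∧ j + a + 2 ≤ m + s0 + 2 * g) := fun h0 => h0.1 hG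
    rw [hvPdef, hvMdef, hnPdef, hnMdef]; dsimp only; rw [if_pos hj, if_pos hj, if_neg hnt, if_neg hnt]
    by_cases haj : a ≤ j
    · obtain ⟨h1, h2⟩ := hC2GEN j a hj haj hG
      rw [h1, h2]; exact ⟨rfl, rfl⟩
    · rw [hEmpD h hh j a (by omega), hEmpD h' hh' j a (by omega), hEmp h hh j a (by omega), hEmp h' hh' j a (by omega)]
      exact ⟨rfl, rfl⟩
  -- (4) `hvOff`: off-diagonal non-generic cells are empty (C-2OFF); `a > j` cells and `j > jl` rows are zero by construction
  have hvOff : ∀ j a, ¬ (a ≤ m ∧ (j + a ≤ m ∨ (2 * a ≤ m ∧ j + a ≤ jl))) → j + m ≠ jl + a → vP j a = 0 ∧ vM j a = 0 := by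
    intro j a hnG hoff
    rw [hvPdef, hvMdef]; dsimp only
    by_cases hj : j ≤ jl
    · have hnt : ¬ (¬ (a ≤ m ∧ (j + a ≤ m ∨ (2 * a ≤ m ∧ j + a ≤ jl))) ∧ j + m = jl + a ∧ j + a + 2 ≤ m + s0 + 2 * g) := fun h0 => hoff h0.2.1
      rw [if_pos hj, if_pos hj, if_neg hnt, if_neg hnt]
      by_cases haj : a ≤ j
      · obtain ⟨h1, h2⟩ := hC2OFF j a hj haj hnG hoff
        rw [h1, h2, Set.ncard_empty, Nat.cast_zero]; exact ⟨rfl, rfl⟩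
      · rw [hEmpD h hh j a (by omega), hEmpD h' hh' j a (by omega), Set.ncard_empty, Nat.cast_zero]; exact ⟨rfl, rfl⟩
    · rw [if_neg hj, if_neg hj]; exact ⟨rfl, rfl⟩
  -- (5) `hvTopE`: near top cells by construction; far top cells by (C-2TOPfarE) (`j + a ≥ m + s0`, the bit doubles); rows `j > jl` are dead (`e ≤ d_E`)
  have hvTopE : ∀ j a, ¬ (a ≤ m ∧ (j + a ≤ m ∨ (2 * a ≤ m ∧ j + a ≤ jl))) → j + m = jl + a →
      (vP j a = if 2 * j + (g + s0) ≤ 2 * jl + 1 + e ∧ (j + a + 2 ≤ m + s0 + 2 * g ∨ ε = 1) then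
          (if j + a < m + s0 then (q : ℚ) ^ j else (if 2 * g ≤ j + a - m - s0 + 1 then 2 else 1) * (q : ℚ) ^ (j - (j + a - m - s0 + 1) / 2)) else 0) ∧
      (vM j a = if 2 * j + (g + s0) ≤ 2 * jl + 1 + e ∧ (j + a + 2 ≤ m + s0 + 2 * g ∨ ε = -1) then
          (if j + a < m + s0 then (q : ℚ) ^ j else (if 2 * g ≤ j + a - m - s0 + 1 then 2 else 1) * (q : ℚ) ^ (j - (j + a - m - s0 + 1) / 2)) else 0) := by
    intro j a hnG hdiag
    rw [hvPdef, hvMdef]; dsimp only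
    by_cases hj : j ≤ jl
    · rw [if_pos hj, if_pos hj]
      by_cases hnear : j + a + 2 ≤ m + s0 + 2 * g
      · have hnt : ¬ (a ≤ m ∧ (j + a ≤ m ∨ (2 * a ≤ m ∧ j + a ≤ jl))) ∧ j + m = jl + a ∧ j + a + 2 ≤ m + s0 + 2 * g := ⟨hnG, hdiag, hnear⟩
        rw [if_pos hnt, if_pos hnt]; exact ⟨rfl, rfl⟩
      · have hnt : ¬ (¬ (a ≤ m ∧ (j + a ≤ m ∨ (2 * a ≤ m ∧ j + a ≤ jl))) ∧ j + m = jl + a ∧ j + a + 2 ≤ m + s0 + 2 * g) := fun h0 => hnear h0.2.2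
        rw [if_neg hnt, if_neg hnt]
        obtain ⟨hP, hM⟩ := hC2TOPfarE j a hj (by omega) hnG hdiag hnear
        have hlt : ¬ (j + a < m + s0) := by omega
        have h2g : 2 * g ≤ j + a - m - s0 + 1 := by omega
        rw [hP, hM, if_neg hlt, if_pos h2g]
        constructor
        · by_cases hc : 2 * j + (g + s0) ≤ 2 * jl + 1 + e ∧ ε = 1
          · have hc' : 2 * j + (g + s0) ≤ 2 * jl + 1 + e ∧ (j + a + 2 ≤ m + s0 + 2 * g ∨ ε = 1) := ⟨hc.1, Or.inr hc.2⟩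
            rw [if_pos hc, if_pos hc']
          · have hc' : ¬ (2 * j + (g + s0) ≤ 2 * jl + 1 + e ∧ (j + a + 2 ≤ m + s0 + 2 * g ∨ ε = 1)) := fun h0 => hc ⟨h0.1, h0.2.resolve_left hnear⟩
            rw [if_neg hc, if_neg hc']
        · by_cases hc : 2 * j + (g + s0) ≤ 2 * jl + 1 + e ∧ ε = -1
          · have hc' : 2 * j + (g + s0) ≤ 2 * jl + 1 + e ∧ (j + a + 2 ≤ m + s0 + 2 * g ∨ ε = -1) := ⟨hc.1, Or.inr hc.2⟩
            rw [if_pos hc, if_pos hc']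
          · have hc' : ¬ (2 * j + (g + s0) ≤ 2 * jl + 1 + e ∧ (j + a + 2 ≤ m + s0 + 2 * g ∨ ε = -1)) := fun h0 => hc ⟨h0.1, h0.2.resolve_left hnear⟩
            rw [if_neg hc, if_neg hc']
    · have hbit : ¬ (2 * j + (g + s0) ≤ 2 * jl + 1 + e ∧ (j + a + 2 ≤ m + s0 + 2 * g ∨ ε = 1)) := fun hc => by omega
      have hbit' : ¬ (2 * j + (g + s0) ≤ 2 * jl + 1 + e ∧ (j + a + 2 ≤ m + s0 + 2 * g ∨ ε = -1)) := fun hc => by omega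
      rw [if_neg hj, if_neg hj, if_neg hbit, if_neg hbit']; exact ⟨rfl, rfl⟩
  -- the ★ cut identity, then unfold the tables on `j ≤ jl`: near top cells contribute `0` to both cut differences
  have key := toricCensusSum_ramM_cut_offset q ε hq hg hs0 hjl hjlS hpar hmS hm hε nP nM vP vM hnP hnM hvGen hvOff e hvTopE C hC hCe
  rw [← key]
  congr 1
  refine sum_congr rfl fun j hj => sum_congr rfl fun a _ => ?_
  have hj' : j ≤ jl := by rw [mem_range] at hj; omega
  congr 1
  by_cases hcut : j + a ≤ C
  · rw [if_pos hcut, if_pos hcut, hvPdef, hvMdef]; dsimp only; rw [if_pos hj', if_pos hj']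
    by_cases hnt : ¬ (a ≤ m ∧ (j + a ≤ m ∨ (2 * a ≤ m ∧ j + a ≤ jl))) ∧ j + m = jl + a ∧ j + a + 2 ≤ m + s0 + 2 * g
    · have hiffP : (2 * j + (g + s0) ≤ 2 * jl + 1 + e ∧ (j + a + 2 ≤ m + s0 + 2 * g ∨ ε = 1)) ↔ 2 * j + (g + s0) ≤ 2 * jl + 1 + e :=
        ⟨fun h0 => h0.1, fun h0 => ⟨h0, Or.inl hnt.2.2⟩⟩
      have hiffM : (2 * j + (g + s0) ≤ 2 * jl + 1 + e ∧ (j + a + 2 ≤ m + s0 + 2 * g ∨ ε = -1)) ↔ 2 * j + (g + s0) ≤ 2 * jl + 1 + e :=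
        ⟨fun h0 => h0.1, fun h0 => ⟨h0, Or.inl hnt.2.2⟩⟩
      rw [if_pos hnt, if_pos hnt, if_congr hiffP rfl rfl, if_congr hiffM rfl rfl, sub_self, hC2TOPnear j a hj' (by omega) hnt.1 hnt.2.1 hnt.2.2, sub_self]
    · rw [if_neg hnt, if_neg hnt]
  · rw [if_neg hcut, if_neg hcut]

/-! ## §2 Flipped parity class -/

/-- **(T5-P-weldΔ)-RamM♭, FLIPPED CLASS — THE CUT WELD modulo the per-cell facts.**  The same with ★ p859973 `toricCensusSum_ramM_flip_cut_offset`'s class letters (`jl ≢ g`,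
`3g + 2s0 ≤ jl + 3`, `m ≢ d_E`, `d_E ≤ m + 1`) and its flipped value `q^m(2[(jl+1−g)∕2 + d_E%2]_q − 2[d_E − 1 + d_E%2]_q)` minus the same cut band.
[cite: Kottwitz1986BaseChangeUnits, §1 pp. 240–241] [cite: Rogawski1990, §4.9 Prop. 4.9.1 (b) p. 55, Lemma 4.9.3 p. 56] [cite: Flicker1998UnitaryFL, Prop. 7 p. 84] [cite: Jacobowitz1962, §4] -/
theorem toricCensusSum_ramM_weld_cut_flip (hD : IsRamifiedQuadraticDatum ρ α dρ t) (hvΘ : ∀ x, Valued.v (Θ x) = Valued.v x)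
    (hρϖ : ρ ϖE = ϖE) (hϖE : Valued.v ϖE = exp (-2 : ℤ)) (hh : h ≠ 0) (hh' : h' ≠ 0)
    (q : ℕ) {g s0 jl m : ℕ} (ε : ℚ) (hq : 2 ≤ q) (hg : 1 ≤ g) (hs0 : 1 ≤ s0) (hjl : jl % 2 = (g + 1) % 2)
    (hjlS : 3 * g + 2 * s0 ≤ jl + 3) (hpar : m % 2 = (g + s0 + 1) % 2)
    (hmS : g + s0 ≤ m + 1) (hm : m ≤ jl) (hε : ε = 1 ∨ (ε = -1 ∧ jl + 2 ≤ m + 2 * g + s0)) {μ : K}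
    (hC1P : ∀ j a, (levelSet ρ Θ α ϖE h j a).ncard = (if j = 0 then (if a = 0 then 1 else 0) else if j < a then 0
      else if j - a + 1 = s0 then q ^ j else if j - a + 1 < s0 then (if a = 0 then q ^ j else 0) else if (j - a - s0) % 2 = 1 then 0
      else if a = 0 then (if 2 * g ≤ j - a - s0 then 2 else 1) * q ^ (j - (j - a - s0) / 2)
      else if j - a - s0 + 2 < 2 * g then (q - 1) * q ^ (j - 1 - (j - a - s0) / 2) else if j - a - s0 + 2 = 2 * g then (q - 2) * q ^ (j - 1 - (j - a - s0) / 2)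
      else 2 * (q - 1) * q ^ (j - 1 - (j - a - s0) / 2) : ℕ))
    (hC1M : ∀ j a, (levelSet ρ Θ α ϖE h' j a).ncard = (if j = 0 then (if a = 0 then 1 else 0) else if j < a then 0
      else if j - a + 1 = s0 then q ^ j else if j - a + 1 < s0 then (if a = 0 then q ^ j else 0) else if (j - a - s0) % 2 = 1 then 0
      else if a = 0 then (if j - a - s0 + 2 ≤ 2 * g then q ^ (j - (j - a - s0) / 2) else 0)
      else if j - a - s0 + 2 < 2 * g then (q - 1) * q ^ (j - 1 - (j - a - s0) / 2) else if j - a - s0 + 2 = 2 * g then q ^ (j - (j - a - s0) / 2) else 0 : ℕ))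
    (hC2GEN : ∀ j a, j ≤ jl → a ≤ j → (a ≤ m ∧ (j + a ≤ m ∨ (2 * a ≤ m ∧ j + a ≤ jl))) →
      levelSetDep ρ Θ α ϖE h j a μ = levelSet ρ Θ α ϖE h j a ∧ levelSetDep ρ Θ α ϖE h' j a μ = levelSet ρ Θ α ϖE h' j a)
    (hC2OFF : ∀ j a, j ≤ jl → a ≤ j → ¬ (a ≤ m ∧ (j + a ≤ m ∨ (2 * a ≤ m ∧ j + a ≤ jl))) → j + m ≠ jl + a →
      levelSetDep ρ Θ α ϖE h j a μ = ∅ ∧ levelSetDep ρ Θ α ϖE h' j a μ = ∅)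
    (hC2TOPnear : ∀ j a, j ≤ jl → a ≤ j → ¬ (a ≤ m ∧ (j + a ≤ m ∨ (2 * a ≤ m ∧ j + a ≤ jl))) → j + m = jl + a → j + a + 2 ≤ m + s0 + 2 * g →
      (levelSetDep ρ Θ α ϖE h j a μ).ncard = (levelSetDep ρ Θ α ϖE h' j a μ).ncard)
    (e : ℕ) (hed : e ≤ g + s0)
    (hC2TOPfarE : ∀ j a, j ≤ jl → a ≤ j → ¬ (a ≤ m ∧ (j + a ≤ m ∨ (2 * a ≤ m ∧ j + a ≤ jl))) → j + m = jl + a → ¬ (j + a + 2 ≤ m + s0 + 2 * g) →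
      (((levelSetDep ρ Θ α ϖE h j a μ).ncard : ℚ) = if 2 * j + (g + s0) ≤ 2 * jl + 1 + e ∧ ε = 1 then 2 * (q : ℚ) ^ (j - (j + a - m - s0 + 1) / 2) else 0) ∧
      (((levelSetDep ρ Θ α ϖE h' j a μ).ncard : ℚ) = if 2 * j + (g + s0) ≤ 2 * jl + 1 + e ∧ ε = -1 then 2 * (q : ℚ) ^ (j - (j + a - m - s0 + 1) / 2) else 0))
    (C : ℕ) (hC : jl ≤ C) (hCe : C + (g + s0) ≤ m + jl + 1) :
    ε * ∑ j ∈ range (jl + 1), ∑ a ∈ range (jl + 2), (q : ℚ) ^ a *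
        (if j + a ≤ C then ((levelSetDep ρ Θ α ϖE h j a μ).ncard : ℚ) - ((levelSetDep ρ Θ α ϖE h' j a μ).ncard : ℚ) else 0) =
      (q : ℚ) ^ m * (2 * ∑ i ∈ range ((jl + 1 - g) / 2 + (g + s0) % 2), (q : ℚ) ^ i - 2 * ∑ i ∈ range (g + s0 - 1 + (g + s0) % 2), (q : ℚ) ^ i) -
        2 * ∑ a ∈ (range (jl + 2)).filter (fun a => a ≤ m ∧ C + m < jl + 2 * a ∧ 2 * m + 2 * g + s0 < jl + 2 * a + 2 ∧ 2 * a + (g + s0) ≤ 2 * m + 1),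
          (q : ℚ) ^ (a + (jl + s0) / 2) := by
  classical
  -- as §1, with the flipped ★ cut identity
  have hEmp : ∀ (s : K), s ≠ 0 → ∀ j a, j < a → levelSet ρ Θ α ϖE s j a = ∅ := fun s hs j a hja =>
    levelSet_eq_empty_of_succ_le_ramified (Θ := Θ) hD hvΘ hρϖ hϖE hs (by omega)
  have hEmpD : ∀ (s : K), s ≠ 0 → ∀ j a, j < a → ∀ μ' : K, levelSetDep ρ Θ α ϖE s j a μ' = ∅ := fun s hs j a hja μ' =>
    Set.subset_eq_empty (levelSetDep_subset ρ Θ α ϖE s j a μ') (hEmp s hs j a hja)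
  -- the tables: the census, except on the NEAR top cells where both sides carry the explicit alive-offset value
  obtain ⟨nP, hnPdef⟩ : ∃ f : ℕ → ℕ → ℚ, f = fun j a => ((levelSet ρ Θ α ϖE h j a).ncard : ℚ) := ⟨_, rfl⟩
  obtain ⟨nM, hnMdef⟩ : ∃ f : ℕ → ℕ → ℚ, f = fun j a => ((levelSet ρ Θ α ϖE h' j a).ncard : ℚ) := ⟨_, rfl⟩
  obtain ⟨vP, hvPdef⟩ : ∃ f : ℕ → ℕ → ℚ, f = fun j a => if j ≤ jl then
      (if ¬ (a ≤ m ∧ (j + a ≤ m ∨ (2 * a ≤ m ∧ j + a ≤ jl))) ∧ j + m = jl + a ∧ j + a + 2 ≤ m + s0 + 2 * g then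
        (if 2 * j + (g + s0) ≤ 2 * jl + 1 + e ∧ (j + a + 2 ≤ m + s0 + 2 * g ∨ ε = 1) then
          (if j + a < m + s0 then (q : ℚ) ^ j else (if 2 * g ≤ j + a - m - s0 + 1 then 2 else 1) * (q : ℚ) ^ (j - (j + a - m - s0 + 1) / 2)) else 0)
      else ((levelSetDep ρ Θ α ϖE h j a μ).ncard : ℚ)) else 0 := ⟨_, rfl⟩
  obtain ⟨vM, hvMdef⟩ : ∃ f : ℕ → ℕ → ℚ, f = fun j a => if j ≤ jl then
      (if ¬ (a ≤ m ∧ (j + a ≤ m ∨ (2 * a ≤ m ∧ j + a ≤ jl))) ∧ j + m = jl + a ∧ j + a + 2 ≤ m + s0 + 2 * g then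
        (if 2 * j + (g + s0) ≤ 2 * jl + 1 + e ∧ (j + a + 2 ≤ m + s0 + 2 * g ∨ ε = -1) then
          (if j + a < m + s0 then (q : ℚ) ^ j else (if 2 * g ≤ j + a - m - s0 + 1 then 2 else 1) * (q : ℚ) ^ (j - (j + a - m - s0 + 1) / 2)) else 0)
      else ((levelSetDep ρ Θ α ϖE h' j a μ).ncard : ℚ)) else 0 := ⟨_, rfl⟩
  have hnP : ∀ j a, nP j a = ((if j = 0 then (if a = 0 then 1 else 0) else if j < a then 0
      else if j - a + 1 = s0 then q ^ j else if j - a + 1 < s0 then (if a = 0 then q ^ j else 0) else if (j - a - s0) % 2 = 1 then 0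
      else if a = 0 then (if 2 * g ≤ j - a - s0 then 2 else 1) * q ^ (j - (j - a - s0) / 2)
      else if j - a - s0 + 2 < 2 * g then (q - 1) * q ^ (j - 1 - (j - a - s0) / 2) else if j - a - s0 + 2 = 2 * g then (q - 2) * q ^ (j - 1 - (j - a - s0) / 2)
      else 2 * (q - 1) * q ^ (j - 1 - (j - a - s0) / 2) : ℕ) : ℚ) := fun j a => by
    rw [hnPdef]; dsimp only; rw [hC1P j a]
  have hnM : ∀ j a, nM j a = ((if j = 0 then (if a = 0 then 1 else 0) else if j < a then 0
      else if j - a + 1 = s0 then q ^ j else if j - a + 1 < s0 then (if a = 0 then q ^ j else 0) else if (j - a - s0) % 2 = 1 then 0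
      else if a = 0 then (if j - a - s0 + 2 ≤ 2 * g then q ^ (j - (j - a - s0) / 2) else 0)
      else if j - a - s0 + 2 < 2 * g then (q - 1) * q ^ (j - 1 - (j - a - s0) / 2) else if j - a - s0 + 2 = 2 * g then q ^ (j - (j - a - s0) / 2) else 0 : ℕ) : ℚ) :=
    fun j a => by rw [hnMdef]; dsimp only; rw [hC1M j a]
  -- (3) `hvGen`: generic cells pass wholly (C-2GEN); `a > j` cells are empty on both counts
  have hvGen : ∀ j a, (a ≤ m ∧ (j + a ≤ m ∨ (2 * a ≤ m ∧ j + a ≤ jl))) → vP j a = nP j a ∧ vM j a = nM j a := by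
    intro j a hG
    have hj : j ≤ jl := by omega
    have hnt : ¬ (¬ (a ≤ m ∧ (j + a ≤ m ∨ (2 * a ≤ m ∧ j + a ≤ jl))) ∧ j + m = jl + a ∧ j + a + 2 ≤ m + s0 + 2 * g) := fun h0 => h0.1 hG
    rw [hvPdef, hvMdef, hnPdef, hnMdef]; dsimp only; rw [if_pos hj, if_pos hj, if_neg hnt, if_neg hnt]
    by_cases haj : a ≤ j
    · obtain ⟨h1, h2⟩ := hC2GEN j a hj haj hG
      rw [h1, h2]; exact ⟨rfl, rfl⟩
    · rw [hEmpD h hh j a (by omega), hEmpD h' hh' j a (by omega), hEmp h hh j a (by omega), hEmp h' hh' j a (by omega)]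
      exact ⟨rfl, rfl⟩
  -- (4) `hvOff`: off-diagonal non-generic cells are empty (C-2OFF); `a > j` cells and `j > jl` rows are zero by construction
  have hvOff : ∀ j a, ¬ (a ≤ m ∧ (j + a ≤ m ∨ (2 * a ≤ m ∧ j + a ≤ jl))) → j + m ≠ jl + a → vP j a = 0 ∧ vM j a = 0 := by
    intro j a hnG hoff
    rw [hvPdef, hvMdef]; dsimp only
    by_cases hj : j ≤ jl
    · have hnt : ¬ (¬ (a ≤ m ∧ (j + a ≤ m ∨ (2 * a ≤ m ∧ j + a ≤ jl))) ∧ j + m = jl + a ∧ j + a + 2 ≤ m + s0 + 2 * g) := fun h0 => hoff h0.2.1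
      rw [if_pos hj, if_pos hj, if_neg hnt, if_neg hnt]
      by_cases haj : a ≤ j
      · obtain ⟨h1, h2⟩ := hC2OFF j a hj haj hnG hoff
        rw [h1, h2, Set.ncard_empty, Nat.cast_zero]; exact ⟨rfl, rfl⟩
      · rw [hEmpD h hh j a (by omega), hEmpD h' hh' j a (by omega), Set.ncard_empty, Nat.cast_zero]; exact ⟨rfl, rfl⟩
    · rw [if_neg hj, if_neg hj]; exact ⟨rfl, rfl⟩
  -- (5) `hvTopE`: near top cells by construction; far top cells by (C-2TOPfarE) (`j + a ≥ m + s0`, the bit doubles); rows `j > jl` are dead (`e ≤ d_E`)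
  have hvTopE : ∀ j a, ¬ (a ≤ m ∧ (j + a ≤ m ∨ (2 * a ≤ m ∧ j + a ≤ jl))) → j + m = jl + a →
      (vP j a = if 2 * j + (g + s0) ≤ 2 * jl + 1 + e ∧ (j + a + 2 ≤ m + s0 + 2 * g ∨ ε = 1) then
          (if j + a < m + s0 then (q : ℚ) ^ j else (if 2 * g ≤ j + a - m - s0 + 1 then 2 else 1) * (q : ℚ) ^ (j - (j + a - m - s0 + 1) / 2)) else 0) ∧
      (vM j a = if 2 * j + (g + s0) ≤ 2 * jl + 1 + e ∧ (j + a + 2 ≤ m + s0 + 2 * g ∨ ε = -1) then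
          (if j + a < m + s0 then (q : ℚ) ^ j else (if 2 * g ≤ j + a - m - s0 + 1 then 2 else 1) * (q : ℚ) ^ (j - (j + a - m - s0 + 1) / 2)) else 0) := by
    intro j a hnG hdiag
    rw [hvPdef, hvMdef]; dsimp only
    by_cases hj : j ≤ jl
    · rw [if_pos hj, if_pos hj]
      by_cases hnear : j + a + 2 ≤ m + s0 + 2 * g
      · have hnt : ¬ (a ≤ m ∧ (j + a ≤ m ∨ (2 * a ≤ m ∧ j + a ≤ jl))) ∧ j + m = jl + a ∧ j + a + 2 ≤ m + s0 + 2 * g := ⟨hnG, hdiag, hnear⟩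
        rw [if_pos hnt, if_pos hnt]; exact ⟨rfl, rfl⟩
      · have hnt : ¬ (¬ (a ≤ m ∧ (j + a ≤ m ∨ (2 * a ≤ m ∧ j + a ≤ jl))) ∧ j + m = jl + a ∧ j + a + 2 ≤ m + s0 + 2 * g) := fun h0 => hnear h0.2.2
        rw [if_neg hnt, if_neg hnt]
        obtain ⟨hP, hM⟩ := hC2TOPfarE j a hj (by omega) hnG hdiag hnear
        have hlt : ¬ (j + a < m + s0) := by omega
        have h2g : 2 * g ≤ j + a - m - s0 + 1 := by omega
        rw [hP, hM, if_neg hlt, if_pos h2g]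
        constructor
        · by_cases hc : 2 * j + (g + s0) ≤ 2 * jl + 1 + e ∧ ε = 1
          · have hc' : 2 * j + (g + s0) ≤ 2 * jl + 1 + e ∧ (j + a + 2 ≤ m + s0 + 2 * g ∨ ε = 1) := ⟨hc.1, Or.inr hc.2⟩
            rw [if_pos hc, if_pos hc']
          · have hc' : ¬ (2 * j + (g + s0) ≤ 2 * jl + 1 + e ∧ (j + a + 2 ≤ m + s0 + 2 * g ∨ ε = 1)) := fun h0 => hc ⟨h0.1, h0.2.resolve_left hnear⟩
            rw [if_neg hc, if_neg hc']
        · by_cases hc : 2 * j + (g + s0) ≤ 2 * jl + 1 + e ∧ ε = -1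
          · have hc' : 2 * j + (g + s0) ≤ 2 * jl + 1 + e ∧ (j + a + 2 ≤ m + s0 + 2 * g ∨ ε = -1) := ⟨hc.1, Or.inr hc.2⟩
            rw [if_pos hc, if_pos hc']
          · have hc' : ¬ (2 * j + (g + s0) ≤ 2 * jl + 1 + e ∧ (j + a + 2 ≤ m + s0 + 2 * g ∨ ε = -1)) := fun h0 => hc ⟨h0.1, h0.2.resolve_left hnear⟩
            rw [if_neg hc, if_neg hc']
    · have hbit : ¬ (2 * j + (g + s0) ≤ 2 * jl + 1 + e ∧ (j + a + 2 ≤ m + s0 + 2 * g ∨ ε = 1)) := fun hc => by omega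
      have hbit' : ¬ (2 * j + (g + s0) ≤ 2 * jl + 1 + e ∧ (j + a + 2 ≤ m + s0 + 2 * g ∨ ε = -1)) := fun hc => by omega
      rw [if_neg hj, if_neg hj, if_neg hbit, if_neg hbit']; exact ⟨rfl, rfl⟩
  -- the ★ cut identity, then unfold the tables on `j ≤ jl`: near top cells contribute `0` to both cut differences
  have key := toricCensusSum_ramM_flip_cut_offset q ε hq hg hs0 hjl hjlS hpar hmS hm hε nP nM vP vM hnP hnM hvGen hvOff e hvTopE C hC hCe
  rw [← key]
  congr 1
  refine sum_congr rfl fun j hj => sum_congr rfl fun a _ => ?_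
  have hj' : j ≤ jl := by rw [mem_range] at hj; omega
  congr 1
  by_cases hcut : j + a ≤ C
  · rw [if_pos hcut, if_pos hcut, hvPdef, hvMdef]; dsimp only; rw [if_pos hj', if_pos hj']
    by_cases hnt : ¬ (a ≤ m ∧ (j + a ≤ m ∨ (2 * a ≤ m ∧ j + a ≤ jl))) ∧ j + m = jl + a ∧ j + a + 2 ≤ m + s0 + 2 * g
    · have hiffP : (2 * j + (g + s0) ≤ 2 * jl + 1 + e ∧ (j + a + 2 ≤ m + s0 + 2 * g ∨ ε = 1)) ↔ 2 * j + (g + s0) ≤ 2 * jl + 1 + e :=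
        ⟨fun h0 => h0.1, fun h0 => ⟨h0, Or.inl hnt.2.2⟩⟩
      have hiffM : (2 * j + (g + s0) ≤ 2 * jl + 1 + e ∧ (j + a + 2 ≤ m + s0 + 2 * g ∨ ε = -1)) ↔ 2 * j + (g + s0) ≤ 2 * jl + 1 + e :=
        ⟨fun h0 => h0.1, fun h0 => ⟨h0, Or.inl hnt.2.2⟩⟩
      rw [if_pos hnt, if_pos hnt, if_congr hiffP rfl rfl, if_congr hiffM rfl rfl, sub_self, hC2TOPnear j a hj' (by omega) hnt.1 hnt.2.1 hnt.2.2, sub_self]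
    · rw [if_neg hnt, if_neg hnt]
  · rw [if_neg hcut, if_neg hcut]

end Summit.HodgeConjecture.HodgeConjecture.Cruxes.H413.F0P3cDyRamToricCensusSumRamMWeldCut
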